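import Summits.ValiantsHypothesis.ValiantsHypothesis.Theorems.KPlusLogSqLawTropicalBTopHeavyCoreArc
import Summits.ValiantsHypothesis.ValiantsHypothesis.Theorems.KPlusLogSqLawTropicalBParityCensus
import Summits.ValiantsHypothesis.ValiantsHypothesis.Theorems.KPlusLogSqLawTropicalBSplitDefs

/-!
# Route «KPlusLogSqLaw», crux `TropicalB` (stmt-ValiantsHypothesis-19771) — THE TOP-HEAVY CENSUS:
# for EVERY `m ≥ 2` a cell whose top class outweighs the core slopes misses a histogram (`n + 2 ≤ multichoose K m`)

HONEST FRAMING.  Census corollary of this seat's CORE LAW C (`TopHeavyCore.core_law_C`, …TopHeavyCoreArc; val-sym-trop-p1 g21, cell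
`pub-symmetroid`, 2026-08-28; `--supports stmt-ValiantsHypothesis-19771 --as helper`).  Finite-format statements about the UNSIGNED census of
dominance designs (`DesignRowD`, …TropicalBSplitDefs): one more infinite family of deficient cells, decided by ONE mechanism valid for every
size `m ≥ 2` (odd and even alike) — complementing `ParityLaw.parity_census` (`m` even, `K ≥ 5`), `LexCore.lex_census` (`m ≥ 4`, `K ≥ 4`, core
slopes ordered) and the `m = 3` patterns of …TropicalBForbiddenPatterns (convex / concave exponent regions).  The region here is NEW at every
`m`: no convexity among `d c₀ … d c₃` is asked, only that the top class `c₄` be heavy («top-heavy»: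
`d c₄ + (m−1)·d c₀ > max((m−2)·d c₁ + 2·d c₂, (m−1)·d c₁ + d c₃)`), e.g. `d = (0, 1, 2, 3, m + 3)` at every `m ≥ 2`.  The deficiency proved
is ONE histogram per quintuple — a calibration datum, not a bound of `TropicalB` shape; nothing here bears on `TropicalB` in its window,
`WeakLifting`, DoorA26 / DoorA34, `MatrixDescartes` (stmt-ValiantsHypothesis-18050) or VP ≠ VNP.

* `twoSame_of_classSym` — reading the class function off the multiset `2·{c₂} + (m−2)·{c₁}`.
* `core_census` — **`m ≥ 2`; classes with `d c₀ < d c₁ < d c₂ < d c₃`, `d c₀ = min d`, and a class `c₄` with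
  `(m−2)·d c₁ + 2·d c₂ < (m−1)·d c₀ + d c₄` and `(m−1)·d c₁ + d c₃ < (m−1)·d c₀ + d c₄`: every chain of unique optima at strictly increasing
  slopes with consecutive terms distinct has `n + 2 ≤ multichoose K m`** (it misses `c₁^{m−2}c₂²`, `c₁^{m−1}c₃` or `c₀^{m−1}c₄`).
* `designRowD_core` — the `DesignRowD` form (`≤ multichoose K m − 2`, one below slope counting).
* `core_census_superIncreasing` — exponents super-increasing by the size, five classes with increasing exponents above the minimum:
  **no lexicographic cell with `m ≥ 2` and five exponent values above-or-at the minimum is counting-tight** — ALL sizes by one mechanism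
  (the parity census needs `m` even, the lex census `m ≥ 4`; at `m = 3` this re-derives the convex case of …ForbiddenPatterns structurally).
* `designRowD_topHeavy_five`, `designRowD_topHeavy_five_example` — the `K = 5` column: sorted `d : Fin 5 → ℕ` with `d 4` top-heavy, and the
  instance `d = (0, 1, 2, 3, m + 3)` for every `m ≥ 2` (at `m = 3`: `(0,1,2,3,6)`, outside both kernel regions of …ForbiddenPatterns).
[this cell]
-/

set_option linter.dupNamespace false
set_option autoImplicit false

namespace Summit.ValiantsHypothesis.ValiantsHypothesis.Theorems.KPlusLogSqLaw.TopHeavyCore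

open Summit.ValiantsHypothesis.ValiantsHypothesis.Theorems.MatrixDescartes.Negative
open Summit.ValiantsHypothesis.ValiantsHypothesis.Theorems.LacunarySymmetroidMatrixDescartes.TropicalCensus
open Finset

variable {m K : ℕ}

/-- a term whose class multiset is `2·{c₂} + (m−2)·{c₁}` (`c₁ ≠ c₂`) has class `c₂` at exactly two columns `a₁ ≠ a₂` and `c₁` elsewhere.
[folklore] -/
theorem twoSame_of_classSym {p : Equiv.Perm (Fin m) × (Fin m → Fin K)} {c₁ c₂ : Fin K} (h12 : c₁ ≠ c₂)
    (h : (classSym p : Multiset (Fin K)) = c₂ ::ₘ c₂ ::ₘ Multiset.replicate (m - 2) c₁) :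
    ∃ a₁ a₂ : Fin m, a₁ ≠ a₂ ∧ ∀ x, p.2 x = if x = a₁ ∨ x = a₂ then c₂ else c₁ := by
  have hval : (classSym p : Multiset (Fin K)) = (univ : Finset (Fin m)).val.map p.2 := rfl
  -- the columns of class `c₂` are exactly two
  have hcount : Multiset.count c₂ ((univ : Finset (Fin m)).val.map p.2) = 2 := by
    rw [← hval, h, Multiset.count_cons_self, Multiset.count_cons_self, Multiset.count_replicate, if_neg h12]
  have hcard : (univ.filter fun a => c₂ = p.2 a).card = 2 := by
    rw [Finset.card_def, Finset.filter_val, ← Multiset.count_map p.2 (univ : Finset (Fin m)).val c₂, hcount]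
  obtain ⟨a₁, a₂, hne, hS⟩ := Finset.card_eq_two.mp hcard
  refine ⟨a₁, a₂, hne, fun x => ?_⟩
  have hiff : c₂ = p.2 x ↔ x = a₁ ∨ x = a₂ := by
    have := Finset.ext_iff.mp hS x
    simpa only [mem_filter, mem_univ, true_and, mem_insert, mem_singleton] using this
  by_cases hx : x = a₁ ∨ x = a₂
  · rw [if_pos hx]; exact (hiff.mpr hx).symm
  · rw [if_neg hx]
    have hmem : p.2 x ∈ (univ : Finset (Fin m)).val.map p.2 := Multiset.mem_map_of_mem _ (mem_univ x)
    rw [← hval, h, Multiset.mem_cons, Multiset.mem_cons] at hmem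
    rcases hmem with hx2 | hx2 | hx1
    · exact absurd (hiff.mp hx2.symm) hx
    · exact absurd (hiff.mp hx2.symm) hx
    · exact Multiset.eq_of_mem_replicate hx1

/-- **THE TOP-HEAVY CENSUS.**  `m ≥ 2`; classes `c₀ c₁ c₂ c₃` with `d c₀ < d c₁ < d c₂ < d c₃` and `d c₀` minimal, and a class `c₄` whose
exponent outweighs both core slopes: `(m−2)·d c₁ + 2·d c₂ < (m−1)·d c₀ + d c₄` and `(m−1)·d c₁ + d c₃ < (m−1)·d c₀ + d c₄`.  Every chain of
unique optima at strictly increasing slopes with consecutive terms distinct has `n + 2 ≤ multichoose K m`: it misses one of the histograms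
`c₁^{m−2} c₂²`, `c₁^{m−1} c₃`, `c₀^{m−1} c₄` (Core Law C). [this cell] -/
theorem core_census (hm : 2 ≤ m) (d : Fin K → ℕ) (v ε : Fin m → Fin m → Fin K → ℤ) (c₀ c₁ c₂ c₃ c₄ : Fin K)
    (h01 : d c₀ < d c₁) (h12 : d c₁ < d c₂) (h23 : d c₂ < d c₃) (hmin : ∀ l, d c₀ ≤ d l)
    (hAC : (m - 2 : ℤ) * d c₁ + 2 * d c₂ < (m - 1 : ℤ) * d c₀ + d c₄)
    (hBC : (m - 1 : ℤ) * d c₁ + d c₃ < (m - 1 : ℤ) * d c₀ + d c₄)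
    {n : ℕ} (θ : Fin (n + 1) → ℤ) (p : Fin (n + 1) → Equiv.Perm (Fin m) × (Fin m → Fin K))
    (hθ : StrictMono θ) (hdom : ∀ k, IsDominant d v ε (θ k) (p k)) (hne : ∀ k : Fin n, p k.castSucc ≠ p k.succ) :
    n + 2 ≤ Nat.multichoose K m := by
  classical
  by_contra hlt
  have hn : Nat.multichoose K m ≤ n + 1 := by omega
  obtain ⟨hsm, hsurj⟩ := ParityLaw.classSym_surjective_of_full d v ε θ p hθ hdom hne hn
  -- the three core multisets
  have cardA : Multiset.card (c₂ ::ₘ c₂ ::ₘ Multiset.replicate (m - 2) c₁) = m := by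
    rw [Multiset.card_cons, Multiset.card_cons, Multiset.card_replicate]; omega
  have cardB : Multiset.card (c₃ ::ₘ Multiset.replicate (m - 1) c₁) = m := by
    rw [Multiset.card_cons, Multiset.card_replicate]; omega
  have cardC : Multiset.card (c₄ ::ₘ Multiset.replicate (m - 1) c₀) = m := by
    rw [Multiset.card_cons, Multiset.card_replicate]; omega
  obtain ⟨kA, hkA⟩ := hsurj ⟨c₂ ::ₘ c₂ ::ₘ Multiset.replicate (m - 2) c₁, cardA⟩
  obtain ⟨kB, hkB⟩ := hsurj ⟨c₃ ::ₘ Multiset.replicate (m - 1) c₁, cardB⟩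
  obtain ⟨kC, hkC⟩ := hsurj ⟨c₄ ::ₘ Multiset.replicate (m - 1) c₀, cardC⟩
  have hkA' : (classSym (p kA) : Multiset (Fin K)) = c₂ ::ₘ c₂ ::ₘ Multiset.replicate (m - 2) c₁ := congrArg Subtype.val hkA
  have hkB' : (classSym (p kB) : Multiset (Fin K)) = c₃ ::ₘ Multiset.replicate (m - 1) c₁ := congrArg Subtype.val hkB
  have hkC' : (classSym (p kC) : Multiset (Fin K)) = c₄ ::ₘ Multiset.replicate (m - 1) c₀ := congrArg Subtype.val hkC
  -- exponent facts
  have h01z : (d c₀ : ℤ) < d c₁ := by exact_mod_cast h01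
  have h12z : (d c₁ : ℤ) < d c₂ := by exact_mod_cast h12
  have h23z : (d c₂ : ℤ) < d c₃ := by exact_mod_cast h23
  have hm1 : (1 : ℤ) ≤ (m : ℤ) - 1 := by
    have : (2 : ℤ) ≤ m := by exact_mod_cast hm
    linarith
  have h04 : d c₀ < d c₄ := by
    have hmul : ((m : ℤ) - 1) * d c₀ ≤ ((m : ℤ) - 1) * d c₁ := mul_le_mul_of_nonneg_left h01z.le (by linarith)
    have : (d c₀ : ℤ) < d c₄ := by linarith
    exact_mod_cast this
  -- shapes
  obtain ⟨a₁, a₂, hne12, hlA⟩ := twoSame_of_classSym (fun h => (ne_of_lt h12) (by rw [h])) hkA'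
  obtain ⟨b, hb, hlB⟩ := ParityLaw.oneOff_of_classSym_cons (fun h => (ne_of_lt (h12.trans h23)) (by rw [h])) hkB'
  obtain ⟨c, hc, hlC⟩ := ParityLaw.oneOff_of_classSym_cons (fun h => (ne_of_lt h04) (by rw [h])) hkC'
  have hlB' : ∀ x, (p kB).2 x = if x = b then c₃ else c₁ := by
    intro x
    by_cases hx : x = b
    · rw [if_pos hx, hx, hb]
    · rw [if_neg hx, hlB x hx]
  have hlC' : ∀ x, (p kC).2 x = if x = c then c₄ else c₀ := by
    intro x
    by_cases hx : x = c
    · rw [if_pos hx, hx, hc]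
    · rw [if_neg hx, hlC x hx]
  -- slopes of the three terms
  have slA : slope d (p kA) = (d c₂ : ℤ) + d c₂ + (m - 2 : ℤ) * d c₁ := by
    rw [slope_eq_of_classSym, hkA', Multiset.map_cons, Multiset.sum_cons, Multiset.map_cons, Multiset.sum_cons, Multiset.map_replicate,
      Multiset.sum_replicate, nsmul_eq_mul]
    push_cast [Nat.cast_sub hm]
    ring
  have slB : slope d (p kB) = (d c₃ : ℤ) + (m - 1 : ℤ) * d c₁ := by
    rw [slope_eq_of_classSym, hkB', Multiset.map_cons, Multiset.sum_cons, Multiset.map_replicate, Multiset.sum_replicate,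
      nsmul_eq_mul]
    push_cast [Nat.cast_sub (by omega : 1 ≤ m)]
    ring
  have slC : slope d (p kC) = (d c₄ : ℤ) + (m - 1 : ℤ) * d c₀ := by
    rw [slope_eq_of_classSym, hkC', Multiset.map_cons, Multiset.sum_cons, Multiset.map_replicate, Multiset.sum_replicate,
      nsmul_eq_mul]
    push_cast [Nat.cast_sub (by omega : 1 ≤ m)]
    ring
  -- index order from slope order, then slope order of the `θ`'s
  have hAC' : kA < kC := by
    have hs : slope d (p kA) < slope d (p kC) := by rw [slA, slC]; linarith
    exact hsm.lt_iff_lt.mp hs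
  have hBC' : kB < kC := by
    have hs : slope d (p kB) < slope d (p kC) := by rw [slB, slC]; linarith
    exact hsm.lt_iff_lt.mp hs
  have hA : IsDominant d v ε (θ kA) ((p kA).1, (p kA).2) := hdom kA
  have hB : IsDominant d v ε (θ kB) ((p kB).1, (p kB).2) := hdom kB
  have hC : IsDominant d v ε (θ kC) ((p kC).1, (p kC).2) := hdom kC
  -- Core Law C
  exact core_law_C d v ε hm h01 h12 h23 hmin hne12 hlA hlB' hlC' hA hB hC (hθ hAC') (hθ hBC')

/-- **TOP-HEAVY CENSUS, `DesignRowD` form**: under the hypotheses of `core_census` the design's unsigned row is at most `multichoose K m − 2`,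
one below slope counting. [this cell] -/
theorem designRowD_core (hm : 2 ≤ m) (d : Fin K → ℕ) (v ε : Fin m → Fin m → Fin K → ℤ) (c₀ c₁ c₂ c₃ c₄ : Fin K)
    (h01 : d c₀ < d c₁) (h12 : d c₁ < d c₂) (h23 : d c₂ < d c₃) (hmin : ∀ l, d c₀ ≤ d l)
    (hAC : (m - 2 : ℤ) * d c₁ + 2 * d c₂ < (m - 1 : ℤ) * d c₀ + d c₄)
    (hBC : (m - 1 : ℤ) * d c₁ + d c₃ < (m - 1 : ℤ) * d c₀ + d c₄) :
    DesignRowD d v ε (Nat.multichoose K m - 2) := by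
  intro n θ p hθ hdom hne
  have := core_census hm d v ε c₀ c₁ c₂ c₃ c₄ h01 h12 h23 hmin hAC hBC θ p hθ hdom hne
  omega

/-- **TOP-HEAVY CENSUS IN THE SUPER-INCREASING SECTOR — ALL SIZES.**  `m ≥ 2`, exponents super-increasing by the size
(`d l < d l' → m·d l < d l'`, the hypothesis of `ParityLaw.parity_census_lex` / `LexCore.lex_census_superIncreasing`), a minimal class `c₀` and
four classes with `d c₀ < d c₁ < d c₂ < d c₃ < d c₄`: every chain of unique optima at strictly increasing slopes with consecutive terms
distinct has `n + 2 ≤ multichoose K m`.  **No lexicographic cell with at least five exponent values is counting-tight, at ANY size `m ≥ 2`**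
— one mechanism for all `m` (the parity census needs `m` even, the lex census `m ≥ 4`). [this cell] -/
theorem core_census_superIncreasing (hm : 2 ≤ m) (d : Fin K → ℕ) (hsup : ∀ l l' : Fin K, d l < d l' → m * d l < d l')
    (v ε : Fin m → Fin m → Fin K → ℤ) (c₀ c₁ c₂ c₃ c₄ : Fin K) (hmin : ∀ l, d c₀ ≤ d l)
    (h01 : d c₀ < d c₁) (h12 : d c₁ < d c₂) (h23 : d c₂ < d c₃) (h34 : d c₃ < d c₄)
    {n : ℕ} (θ : Fin (n + 1) → ℤ) (p : Fin (n + 1) → Equiv.Perm (Fin m) × (Fin m → Fin K))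
    (hθ : StrictMono θ) (hdom : ∀ k, IsDominant d v ε (θ k) (p k)) (hne : ∀ k : Fin n, p k.castSucc ≠ p k.succ) :
    n + 2 ≤ Nat.multichoose K m := by
  have h3 := hsup c₂ c₃ h23   -- m·d c₂ < d c₃
  have h4 := hsup c₃ c₄ h34   -- m·d c₃ < d c₄
  have h3z : (m : ℤ) * d c₂ < d c₃ := by exact_mod_cast h3
  have h4z : (m : ℤ) * d c₃ < d c₄ := by exact_mod_cast h4
  have h12z : (d c₁ : ℤ) < d c₂ := by exact_mod_cast h12
  have h23z : (d c₂ : ℤ) < d c₃ := by exact_mod_cast h23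
  have hmz : (2 : ℤ) ≤ m := by exact_mod_cast hm
  refine core_census hm d v ε c₀ c₁ c₂ c₃ c₄ h01 h12 h23 hmin ?_ ?_ θ p hθ hdom hne
  · -- (m−2)·d c₁ + 2·d c₂ ≤ m·d c₂ < d c₃ < d c₄ ≤ (m−1)·d c₀ + d c₄
    have e1 : ((m : ℤ) - 2) * d c₁ ≤ ((m : ℤ) - 2) * d c₂ := mul_le_mul_of_nonneg_left h12z.le (by linarith)
    have e2 : (0 : ℤ) ≤ ((m : ℤ) - 1) * d c₀ := mul_nonneg (by linarith) (Nat.cast_nonneg _)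
    have e3 : (d c₃ : ℤ) ≤ (m : ℤ) * d c₃ := le_mul_of_one_le_left (Nat.cast_nonneg _) (by linarith)
    nlinarith
  · -- (m−1)·d c₁ + d c₃ ≤ m·d c₃ < d c₄
    have e1 : ((m : ℤ) - 1) * d c₁ ≤ ((m : ℤ) - 1) * d c₃ := mul_le_mul_of_nonneg_left (h12z.trans h23z).le (by linarith)
    have e2 : (0 : ℤ) ≤ ((m : ℤ) - 1) * d c₀ := mul_nonneg (by linarith) (Nat.cast_nonneg _)
    nlinarith

/-- **THE `K = 5` COLUMN: A TOP-HEAVY FIFTH CLASS IS NEVER COUNTING-TIGHT (`m ≥ 2`).**  For sorted `d : Fin 5 → ℕ` (`d 0 < d 1 < d 2 < d 3`)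
with `(m−2)·d 1 + 2·d 2 < (m−1)·d 0 + d 4` and `(m−1)·d 1 + d 3 < (m−1)·d 0 + d 4`, every `(m,5)` design with exponents `d` has unsigned row
`≤ multichoose 5 m − 2 = C(m+4,4) − 2`. [this cell] -/
theorem designRowD_topHeavy_five (hm : 2 ≤ m) (d : Fin 5 → ℕ) (h01 : d 0 < d 1) (h12 : d 1 < d 2) (h23 : d 2 < d 3) (h04 : d 0 ≤ d 4)
    (hAC : (m - 2 : ℤ) * d 1 + 2 * d 2 < (m - 1 : ℤ) * d 0 + d 4) (hBC : (m - 1 : ℤ) * d 1 + d 3 < (m - 1 : ℤ) * d 0 + d 4)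
    (v ε : Fin m → Fin m → Fin 5 → ℤ) : DesignRowD d v ε (Nat.multichoose 5 m - 2) := by
  refine designRowD_core hm d v ε 0 1 2 3 4 h01 h12 h23 ?_ hAC hBC
  intro l
  fin_cases l
  · exact le_rfl
  · exact h01.le
  · exact (h01.trans h12).le
  · exact (h01.trans (h12.trans h23)).le
  · exact h04

/-- the top-heavy instance `d = (0, 1, 2, 3, m + 3)`, every `m ≥ 2` (at `m = 3`: `(0,1,2,3,6)`, so `T_D(3,5; (0,1,2,3,6)) ≤ 33`). [this cell] -/
theorem designRowD_topHeavy_five_example (hm : 2 ≤ m) (v ε : Fin m → Fin m → Fin 5 → ℤ) :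
    DesignRowD (![0, 1, 2, 3, m + 3] : Fin 5 → ℕ) v ε (Nat.multichoose 5 m - 2) := by
  refine designRowD_topHeavy_five hm _ (by simp) (by simp) (by simp) (by simp) ?_ ?_ v ε
  · simp only [Matrix.cons_val_zero, Matrix.cons_val_one, Matrix.cons_val]
    push_cast
    have : (2 : ℤ) ≤ m := by exact_mod_cast hm
    nlinarith
  · simp only [Matrix.cons_val_zero, Matrix.cons_val_one, Matrix.cons_val]
    push_cast
    have : (2 : ℤ) ≤ m := by exact_mod_cast hm
    nlinarith

end Summit.ValiantsHypothesis.ValiantsHypothesis.Theorems.KPlusLogSqLaw.TopHeavyCore
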